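import Literature.NumberTheory.LFunctions.WeilTwoPrimeOddMarginKBase
import Literature.NumberTheory.LFunctions.WeilBlockRows
import HarnessLib

/-!
# Two-prime odd-margin certificate K: rows 18–35 of the check `D C = I` (odd block)

Part of the odd-block check of `weilCert23K` (`WeilCert.checkDCRow`), `decide +kernel` row by row. Pure proof file; nothing is asserted.
-/

noncomputable section

namespace Literature.NumberTheory.LFunctions

set_option maxHeartbeats 0 in
/-- Kernel check of row 18 of `D C = I` (certificate K). [folklore] -/
theorem checkDCRow1_18_weilCert23K : weilCert23KBase.checkDCRow 1 18 = true := by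
  decide +kernel

set_option maxHeartbeats 0 in
/-- Kernel check of row 19 of `D C = I` (certificate K). [folklore] -/
theorem checkDCRow1_19_weilCert23K : weilCert23KBase.checkDCRow 1 19 = true := by
  decide +kernel

set_option maxHeartbeats 0 in
/-- Kernel check of row 20 of `D C = I` (certificate K). [folklore] -/
theorem checkDCRow1_20_weilCert23K : weilCert23KBase.checkDCRow 1 20 = true := by
  decide +kernel

set_option maxHeartbeats 0 in
/-- Kernel check of row 21 of `D C = I` (certificate K). [folklore] -/
theorem checkDCRow1_21_weilCert23K : weilCert23KBase.checkDCRow 1 21 = true := by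
  decide +kernel

set_option maxHeartbeats 0 in
/-- Kernel check of row 22 of `D C = I` (certificate K). [folklore] -/
theorem checkDCRow1_22_weilCert23K : weilCert23KBase.checkDCRow 1 22 = true := by
  decide +kernel

set_option maxHeartbeats 0 in
/-- Kernel check of row 23 of `D C = I` (certificate K). [folklore] -/
theorem checkDCRow1_23_weilCert23K : weilCert23KBase.checkDCRow 1 23 = true := by
  decide +kernel

set_option maxHeartbeats 0 in
/-- Kernel check of row 24 of `D C = I` (certificate K). [folklore] -/
theorem checkDCRow1_24_weilCert23K : weilCert23KBase.checkDCRow 1 24 = true := by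
  decide +kernel

set_option maxHeartbeats 0 in
/-- Kernel check of row 25 of `D C = I` (certificate K). [folklore] -/
theorem checkDCRow1_25_weilCert23K : weilCert23KBase.checkDCRow 1 25 = true := by
  decide +kernel

set_option maxHeartbeats 0 in
/-- Kernel check of row 26 of `D C = I` (certificate K). [folklore] -/
theorem checkDCRow1_26_weilCert23K : weilCert23KBase.checkDCRow 1 26 = true := by
  decide +kernel

set_option maxHeartbeats 0 in
/-- Kernel check of row 27 of `D C = I` (certificate K). [folklore] -/
theorem checkDCRow1_27_weilCert23K : weilCert23KBase.checkDCRow 1 27 = true := by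
  decide +kernel

set_option maxHeartbeats 0 in
/-- Kernel check of row 28 of `D C = I` (certificate K). [folklore] -/
theorem checkDCRow1_28_weilCert23K : weilCert23KBase.checkDCRow 1 28 = true := by
  decide +kernel

set_option maxHeartbeats 0 in
/-- Kernel check of row 29 of `D C = I` (certificate K). [folklore] -/
theorem checkDCRow1_29_weilCert23K : weilCert23KBase.checkDCRow 1 29 = true := by
  decide +kernel

set_option maxHeartbeats 0 in
/-- Kernel check of row 30 of `D C = I` (certificate K). [folklore] -/
theorem checkDCRow1_30_weilCert23K : weilCert23KBase.checkDCRow 1 30 = true := by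
  decide +kernel

set_option maxHeartbeats 0 in
/-- Kernel check of row 31 of `D C = I` (certificate K). [folklore] -/
theorem checkDCRow1_31_weilCert23K : weilCert23KBase.checkDCRow 1 31 = true := by
  decide +kernel

set_option maxHeartbeats 0 in
/-- Kernel check of row 32 of `D C = I` (certificate K). [folklore] -/
theorem checkDCRow1_32_weilCert23K : weilCert23KBase.checkDCRow 1 32 = true := by
  decide +kernel

set_option maxHeartbeats 0 in
/-- Kernel check of row 33 of `D C = I` (certificate K). [folklore] -/
theorem checkDCRow1_33_weilCert23K : weilCert23KBase.checkDCRow 1 33 = true := by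
  decide +kernel

set_option maxHeartbeats 0 in
/-- Kernel check of row 34 of `D C = I` (certificate K). [folklore] -/
theorem checkDCRow1_34_weilCert23K : weilCert23KBase.checkDCRow 1 34 = true := by
  decide +kernel

set_option maxHeartbeats 0 in
/-- Kernel check of row 35 of `D C = I` (certificate K). [folklore] -/
theorem checkDCRow1_35_weilCert23K : weilCert23KBase.checkDCRow 1 35 = true := by
  decide +kernel


end Literature.NumberTheory.LFunctions
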